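import Summits.RiemannHypothesis.RiemannHypothesis.Theorems.WeilGroundStateMarkovPartPositiveGroundStateConvex
import Literature.NumberTheory.LFunctions.WeilMellinBounds

/-!
# Markov part of Weil's form: the non-negative minimiser is a.e. strictly positive on the window

Support file for item `MarkovPartPositiveGroundState` of route `WeilGroundState`: the
"positivity IMPROVING" half of the Perron–Frobenius mechanism (Reed–Simon XIII.44; for jump
Dirichlet forms, irreducibility ⇒ improving, Lenz–Stollmann–Veselić), rendered variationally.
If a non-negative normalised minimiser `Φ` of `𝓔_a` vanished on a set `Z ⊆ (-a, a)` of positive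
measure, perturb it inside the square root: `M_r = √(Φ² + r²ψ²)` with `ψ` the normalised smooth bump
of the window. The convexity deficit of `M_r` (see `…Convex.lean`) is of FIRST order `r` on the pairs
`(x, y) ∈ Z × P`, `P = {ψ ≤ Φ, Φ > 0}` (`geomMean_deficit_lower`), while the energy budget
`𝓔_a(Φ) + r²𝓔_a(ψ) − E‖M_r‖² = r²(𝓔_a(ψ) − E)` is of second order; since the archimedean jump
density charges every length, this forces `|Z| · |P| = 0`, and `|P| > 0` because
`∫ Φ² = ∫ ψ² = 1`. Result: `nonneg_minimizer_ae_pos`.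

## References

* M. Reed, B. Simon, *Methods of Modern Mathematical Physics IV* (1978), Thm XIII.44.
* D. Lenz, P. Stollmann, I. Veselić, *The Allegretto–Piepenbrink theorem for strongly local forms*
  / irreducibility and positivity improving semigroups (2009).
-/

-- `Summit.RiemannHypothesis.RiemannHypothesis.…` repeats the summit name by design (D-0017 layout).
set_option linter.dupNamespace false

noncomputable section

open MeasureTheory Set Filter
open scoped Topology ENNReal NNReal

namespace Summit.RiemannHypothesis.RiemannHypothesis.Theorems.WeilGroundStateMarkovPart

open Literature.NumberTheory.LFunctions

/-- **A normalised smooth bump of the window**: for `a > 0` there is a smooth compactly supported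
real `ψ ≥ 0`, vanishing off `[-a, a]`, strictly positive on `(-a, a)`, with `∫ ψ² = 1`, whose
complex embedding is a test function (Mathlib's `ContDiffBump`, normalised in `L²`). -/
theorem exists_window_bump {a : ℝ} (ha : 0 < a) :
    ∃ ψ : ℝ → ℝ, Measurable ψ ∧ (∀ x, 0 ≤ ψ x) ∧ (∀ x, x ∉ Icc (-a) a → ψ x = 0) ∧
      (∀ x ∈ Ioo (-a) a, 0 < ψ x) ∧ ∫ x, ψ x ^ 2 = 1 ∧ IsWeilTest (fun x ↦ (ψ x : ℂ)) := by
  let b : ContDiffBump (0 : ℝ) := ⟨a / 2, a, by positivity, by linarith⟩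
  have hbt : IsWeilTest fun x ↦ ((b x : ℝ) : ℂ) :=
    ⟨Complex.ofRealCLM.contDiff.comp b.contDiff, b.hasCompactSupport.comp_left Complex.ofReal_zero⟩
  have hb0 : ∀ x, x ∉ Icc (-a) a → b x = 0 := fun x hx ↦ by
    refine b.zero_of_le_dist ?_
    rw [dist_zero_right, Real.norm_eq_abs]
    by_contra h
    exact hx (abs_le.1 (not_le.1 h).le) |> fun h' ↦ h' |>.elim
  have hbpos : ∀ x ∈ Ioo (-a) a, 0 < b x := fun x hx ↦
    b.pos_of_mem_ball (by simpa [Metric.mem_ball, dist_zero_right, abs_lt] using hx)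
  set N : ℝ := ∫ x, b x ^ 2 with hN
  have hNn : 0 ≤ N := integral_nonneg fun _ ↦ sq_nonneg _
  have hNpos : 0 < N := by
    rcases hNn.eq_or_lt with hz | hpos
    · exfalso
      have h0 : (fun x ↦ ((b x : ℝ) : ℂ)) = 0 := by
        refine hbt.eq_zero_of_integral_norm_sq_eq_zero ?_
        rw [integral_norm_sq_ofReal, ← hN, ← hz]
      have h1 := congrFun h0 0
      have hb1 : b 0 = 1 := b.one_of_mem_closedBall (Metric.mem_closedBall_self (by positivity))
      simp [hb1] at h1
    · exact hpos
  set κ : ℝ := (Real.sqrt N)⁻¹ with hκ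
  have hκpos : 0 < κ := inv_pos.2 (Real.sqrt_pos.2 hNpos)
  refine ⟨fun x ↦ κ * b x, b.continuous.measurable.const_mul κ,
    fun x ↦ mul_nonneg hκpos.le (b.nonneg' x), fun x hx ↦ by simp [hb0 x hx],
    fun x hx ↦ mul_pos hκpos (hbpos x hx), ?_, ?_⟩
  · have : (fun x ↦ (κ * b x) ^ 2) = fun x ↦ κ ^ 2 * b x ^ 2 := by funext x; ring
    rw [this, integral_const_mul, hκ, inv_pow, Real.sq_sqrt hNn, ← hN, inv_mul_cancel₀ hNpos.ne']
  · have : (fun x ↦ ((κ * b x : ℝ) : ℂ)) = fun x ↦ (κ : ℂ) * ((b x : ℝ) : ℂ) := by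
      funext x; push_cast; ring
    rw [this]
    exact hbt.const_mul κ

/-- If `Φ ≥ 0` and `ψ` have `∫ Φ² = ∫ ψ² = 1`, the set where `ψ ≤ Φ` and `Φ > 0` has positive measure
(otherwise `Φ² < ψ²` wherever `Φ > 0`, forcing `∫ Φ² < ∫ ψ²` or `Φ = 0` a.e.). -/
theorem measure_le_and_pos_ne_zero {Φ ψ : ℝ → ℝ}
    (h0 : ∀ x, 0 ≤ Φ x) (hL : MemLp Φ 2) (hLψ : MemLp ψ 2)
    (hn : ∫ x, Φ x ^ 2 = 1) (hnψ : ∫ x, ψ x ^ 2 = 1) :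
    volume {y : ℝ | ψ y ≤ Φ y ∧ 0 < Φ y} ≠ 0 := by
  intro hP
  have hi : Integrable fun x ↦ Φ x ^ 2 := by
    have := (memLp_two_iff_integrable_sq_norm hL.1).1 hL
    simpa only [Real.norm_eq_abs, sq_abs] using this
  have hiψ : Integrable fun x ↦ ψ x ^ 2 := by
    have := (memLp_two_iff_integrable_sq_norm hLψ.1).1 hLψ
    simpa only [Real.norm_eq_abs, sq_abs] using this
  have hae : ∀ᵐ y : ℝ, y ∉ {y : ℝ | ψ y ≤ Φ y ∧ 0 < Φ y} := measure_eq_zero_iff_ae_notMem.1 hP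
  have hle : ∀ᵐ y : ℝ, 0 ≤ ψ y ^ 2 - Φ y ^ 2 := by
    filter_upwards [hae] with y hy
    rcases (h0 y).eq_or_lt with h | h
    · rw [← h]; nlinarith [sq_nonneg (ψ y)]
    · have : ¬ ψ y ≤ Φ y := fun h' ↦ hy ⟨h', h⟩
      nlinarith [h0 y, not_le.1 this]
  have hint0 : ∫ y, (ψ y ^ 2 - Φ y ^ 2) = 0 := by
    rw [integral_sub hiψ hi, hn, hnψ, sub_self]
  have hzero := (integral_eq_zero_iff_of_nonneg_ae hle (hiψ.sub hi)).1 hint0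
  have hΦ0 : ∀ᵐ y : ℝ, Φ y ^ 2 = 0 := by
    filter_upwards [hae, hzero] with y hy hz
    rcases (h0 y).eq_or_lt with h | h
    · rw [← h]; ring
    · have : ¬ ψ y ≤ Φ y := fun h' ↦ hy ⟨h', h⟩
      simp only [Pi.zero_apply] at hz
      nlinarith [h0 y, not_le.1 this]
  have : ∫ y, Φ y ^ 2 = 0 := by
    rw [integral_congr_ae (hΦ0.mono fun y hy ↦ hy)]
    simp
  rw [hn] at this
  exact one_ne_zero this

/-- **The non-negative minimiser is a.e. strictly positive on the open window** (positivity
improving half of Perron–Frobenius, Reed–Simon XIII.44, variationally). Hypotheses as in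
`nonneg_minimizer_ae_eq` for a single non-negative normalised minimiser `Φ` of the window
`[-a, a]`, `a > 0`. See the module docstring for the proof. -/
theorem nonneg_minimizer_ae_pos {a E : ℝ} (ha : 0 < a) {Φ : ℝ → ℝ}
    (hm : Measurable Φ) (h0 : ∀ x, 0 ≤ Φ x) (hL : MemLp Φ 2)
    (hs : ∀ x, x ∉ Icc (-a) a → Φ x = 0) (hn : ∫ x, Φ x ^ 2 = 1)
    (hfin : IntegrableOn (fun t ↦ weilArchDensity t * weilIncrement (fun x ↦ (Φ x : ℂ)) t)
      (Ioi 0))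
    (hE : weilDirichletEnergy a (fun x ↦ (Φ x : ℂ)) ≤ E)
    (hbot : ∀ v : ℝ → ℂ, MemLp v 2 → (∀ x, x ∉ Icc (-a) a → v x = 0) →
      IntegrableOn (fun t ↦ weilArchDensity t * weilIncrement v t) (Ioi 0) →
      E * ∫ x, ‖v x‖ ^ 2 ≤ weilDirichletEnergy a v) :
    ∀ᵐ x : ℝ, x ∈ Ioo (-a) a → 0 < Φ x := by
  obtain ⟨ψ, hmψ, hψ0, hψs, hψpos, hnψ, hψt⟩ := exists_window_bump ha
  -- `L²` data
  have hLc : MemLp (fun x ↦ (Φ x : ℂ)) 2 := hL.ofReal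
  have hLψc : MemLp (fun x ↦ (ψ x : ℂ)) 2 := hψt.memLp_two
  have hLψ : MemLp ψ 2 := by
    refine (memLp_two_iff_integrable_sq_norm hmψ.aestronglyMeasurable).2 ?_
    have := (memLp_two_iff_integrable_sq_norm hLψc.1).1 hLψc
    simpa only [Complex.norm_real, Real.norm_eq_abs, sq_abs] using this
  have hi : Integrable fun x ↦ Φ x ^ 2 := by
    have := (memLp_two_iff_integrable_sq_norm hL.1).1 hL
    simpa only [Real.norm_eq_abs, sq_abs] using this
  have hiψ : Integrable fun x ↦ ψ x ^ 2 := by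
    have := (memLp_two_iff_integrable_sq_norm hLψ.1).1 hLψ
    simpa only [Real.norm_eq_abs, sq_abs] using this
  have hfinψ := integrableOn_weilArchDensity_mul_weilIncrement hψt
  set C : ℝ := |weilDirichletEnergy a (fun x ↦ (ψ x : ℂ)) - E| with hCdef
  -- the exceptional set and the good set
  set Z : Set ℝ := {x | x ∈ Ioo (-a) a ∧ Φ x = 0} with hZdef
  set P : Set ℝ := {y | ψ y ≤ Φ y ∧ 0 < Φ y} with hPdef
  have hZm : MeasurableSet Z := measurableSet_Ioo.inter (hm (measurableSet_singleton 0))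
  have hPm : MeasurableSet P := (measurableSet_le hmψ hm).inter (measurableSet_lt measurable_const hm)
  have hP : volume P ≠ 0 := measure_le_and_pos_ne_zero h0 hL hLψ hn hnψ
  -- the test kernel
  set k₀ : ℝ → ℝ → ℝ := fun x y ↦ if x ∈ Z ∧ y ∈ P then ψ x * Φ y else 0 with hk₀def
  have hk₀0 : ∀ x y, 0 ≤ k₀ x y := fun x y ↦ by
    simp only [hk₀def]
    split_ifs
    · exact mul_nonneg (hψ0 x) (h0 y)
    · exact le_rfl
  have hk₀m : Measurable (Function.uncurry k₀) := by
    have e : Function.uncurry k₀ = fun p : ℝ × ℝ ↦ if p.1 ∈ Z ∧ p.2 ∈ P then ψ p.1 * Φ p.2 else 0 := by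
      funext p; rfl
    rw [e]
    refine Measurable.ite ?_ ((hmψ.comp measurable_fst).mul (hm.comp measurable_snd))
      measurable_const
    exact (measurable_fst hZm).inter (measurable_snd hPm)
  set k : ℝ → ℝ → ℝ := fun x y ↦ k₀ x y + k₀ y x with hkdef
  have hk0 : ∀ x y, 0 ≤ k x y := fun x y ↦ add_nonneg (hk₀0 x y) (hk₀0 y x)
  have hksymm : ∀ x y, k x y = k y x := fun x y ↦ add_comm _ _
  have hkm : Measurable (Function.uncurry k) := by
    have e : Function.uncurry k = fun p : ℝ × ℝ ↦
        Function.uncurry k₀ p + Function.uncurry k₀ (p.2, p.1) := by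
      funext p; rfl
    rw [e]
    exact hk₀m.add (hk₀m.comp (measurable_snd.prodMk measurable_fst))
  set K : ℝ≥0∞ := ∫⁻ t in Ioi (0 : ℝ), ∫⁻ x, ENNReal.ofReal (weilArchDensity t * k x (x + t))
    with hKdef
  -- the deficit estimate for `M_r = √(Φ² + r²ψ²)`
  have key : ∀ r : ℝ, 0 < r → r ≤ 1 / 2 → ENNReal.ofReal r * K ≤ ENNReal.ofReal (2 * (r ^ 2 * C)) := by
    intro r hr hr2
    set M : ℝ → ℝ := fun x ↦ Real.sqrt (1 * Φ x ^ 2 + r ^ 2 * ψ x ^ 2) with hMdef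
    set F : ℝ → ℝ → ℝ := fun x y ↦
      2 * (M x * M y - (1 * Φ x * Φ y + r ^ 2 * ψ x * ψ y)) with hFdef
    have hw₁ : (0 : ℝ) ≤ r ^ 2 := sq_nonneg r
    have hF0 : ∀ x y, 0 ≤ F x y := fun x y ↦
      mul_nonneg zero_le_two (geomMean_deficit_nonneg zero_le_one hw₁)
    have hFsymm : ∀ x y, F x y = F y x := fun x y ↦ by simp only [hFdef]; ring
    have hMm : Measurable M := by
      simp only [hMdef]
      exact ((measurable_const.mul (hm.pow_const 2)).add
        (measurable_const.mul (hmψ.pow_const 2))).sqrt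
    have hid : ∀ x y, ‖(M y : ℂ) - (M x : ℂ)‖ ^ 2 + F x y =
        1 * ‖(Φ y : ℂ) - (Φ x : ℂ)‖ ^ 2 + r ^ 2 * ‖(ψ y : ℂ) - (ψ x : ℂ)‖ ^ 2 := by
      intro x y
      simp only [norm_ofReal_sub_sq, hFdef, hMdef]
      exact geomMean_sq_identity zero_le_one hw₁
    have hMsq : ∀ x, ‖(M x : ℂ)‖ ^ 2 = Φ x ^ 2 + r ^ 2 * ψ x ^ 2 := fun x ↦ by
      rw [Complex.norm_real, Real.norm_eq_abs, sq_abs, hMdef, Real.sq_sqrt (by positivity)]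
      ring
    have hMc : MemLp (fun x ↦ (M x : ℂ)) 2 := by
      refine (memLp_two_iff_integrable_sq_norm
        (Complex.measurable_ofReal.comp hMm).aestronglyMeasurable).2 ?_
      show Integrable (fun x ↦ ‖(M x : ℂ)‖ ^ 2)
      exact (hi.add (hiψ.const_mul _)).congr (Eventually.of_forall fun x ↦ (hMsq x).symm)
    have hMnorm : ∫ x, ‖(M x : ℂ)‖ ^ 2 = 1 + r ^ 2 := by
      simp only [hMsq]
      rw [integral_add hi (hiψ.const_mul _), integral_const_mul, hn, hnψ, mul_one]
    have hMs : ∀ x, x ∉ Icc (-a) a → (M x : ℂ) = 0 := fun x hx ↦ by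
      simp only [hMdef, hs x hx, hψs x hx]
      norm_num
    obtain ⟨hfinM, hdef⟩ := lintegral_deficit_le (a := a) hMc hLc hLψc hF0 hid hfin hfinψ
    have hEM : E * (1 + r ^ 2) ≤ weilDirichletEnergy a (fun x ↦ (M x : ℂ)) := by
      have := hbot _ hMc hMs hfinM
      rwa [hMnorm] at this
    have hdef' : ∫⁻ t in Ioi (0 : ℝ), ∫⁻ x, ENNReal.ofReal (weilArchDensity t * F x (x + t)) ≤
        ENNReal.ofReal (r ^ 2 * C) := by
      refine hdef.trans (ENNReal.ofReal_le_ofReal ?_)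
      have h1 : weilDirichletEnergy a (fun x ↦ (ψ x : ℂ)) - E ≤ C := le_abs_self _
      nlinarith [h1, hEM, hE]
    -- pointwise: `r k ≤ 2 F`
    have hptw : ∀ x y, r * k x y ≤ 2 * F x y := by
      have hone : ∀ x y, r * k₀ x y ≤ F x y := by
        intro x y
        simp only [hk₀def]
        split_ifs with hxy
        · obtain ⟨⟨-, hx0⟩, hyle, -⟩ := hxy
          have := geomMean_deficit_lower (p₁ := ψ x) hr.le hr2 hx0 (hψ0 x) (hψ0 y) hyle
          simp only [hFdef, hMdef]
          linarith
        · rw [mul_zero]; exact hF0 x y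
      intro x y
      have h1 := hone x y
      have h2 := hone y x
      rw [← hFsymm x y] at h2
      simp only [hkdef]
      linarith
    -- integrate
    have hlhs : ENNReal.ofReal r * K =
        ∫⁻ t in Ioi (0 : ℝ), ∫⁻ x, ENNReal.ofReal (weilArchDensity t * (r * k x (x + t))) := by
      rw [hKdef, ← lintegral_const_mul' _ _ ENNReal.ofReal_ne_top]
      refine lintegral_congr fun t ↦ ?_
      rw [← lintegral_const_mul' _ _ ENNReal.ofReal_ne_top]
      refine lintegral_congr fun x ↦ ?_
      rw [← ENNReal.ofReal_mul hr.le]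
      congr 1
      ring
    have hrhs : ∫⁻ t in Ioi (0 : ℝ), ∫⁻ x, ENNReal.ofReal (weilArchDensity t * (2 * F x (x + t))) =
        2 * ∫⁻ t in Ioi (0 : ℝ), ∫⁻ x, ENNReal.ofReal (weilArchDensity t * F x (x + t)) := by
      rw [← lintegral_const_mul' _ _ ENNReal.ofNat_ne_top]
      refine lintegral_congr fun t ↦ ?_
      rw [← lintegral_const_mul' _ _ ENNReal.ofNat_ne_top]
      refine lintegral_congr fun x ↦ ?_
      rw [show (2 : ℝ≥0∞) = ENNReal.ofReal 2 by norm_num, ← ENNReal.ofReal_mul zero_le_two]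
      congr 1
      ring
    have hmono : ∫⁻ t in Ioi (0 : ℝ), ∫⁻ x, ENNReal.ofReal (weilArchDensity t * (r * k x (x + t))) ≤
        ∫⁻ t in Ioi (0 : ℝ), ∫⁻ x, ENNReal.ofReal (weilArchDensity t * (2 * F x (x + t))) := by
      refine lintegral_mono fun t ↦ lintegral_mono fun x ↦ ?_
      rcases le_or_gt (weilArchDensity t) 0 with hρ | hρ
      · rw [ENNReal.ofReal_of_nonpos (mul_nonpos_of_nonpos_of_nonneg hρ
          (mul_nonneg hr.le (hk0 _ _)))]
        exact bot_le
      · exact ENNReal.ofReal_le_ofReal (mul_le_mul_of_nonneg_left (hptw _ _) hρ.le)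
    calc ENNReal.ofReal r * K
        ≤ 2 * ∫⁻ t in Ioi (0 : ℝ), ∫⁻ x, ENNReal.ofReal (weilArchDensity t * F x (x + t)) := by
          rw [hlhs, ← hrhs]; exact hmono
      _ ≤ 2 * ENNReal.ofReal (r ^ 2 * C) := by gcongr
      _ = ENNReal.ofReal (2 * (r ^ 2 * C)) := by
          rw [ENNReal.ofReal_mul zero_le_two]; norm_num
  -- hence `K = 0`
  have hKle : ∀ n : ℕ, K ≤ ENNReal.ofReal (C * (1 / ((n : ℝ) + 1))) := by
    intro n
    have hr : (0 : ℝ) < 1 / (2 * ((n : ℝ) + 1)) := by positivity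
    have hr2 : 1 / (2 * ((n : ℝ) + 1)) ≤ 1 / 2 :=
      one_div_le_one_div_of_le two_pos (by nlinarith [n.cast_nonneg (α := ℝ)])
    have h := key _ hr hr2
    have e : ENNReal.ofReal (2 * ((1 / (2 * ((n : ℝ) + 1))) ^ 2 * C)) =
        ENNReal.ofReal (1 / (2 * ((n : ℝ) + 1))) * ENNReal.ofReal (C * (1 / ((n : ℝ) + 1))) := by
      rw [← ENNReal.ofReal_mul hr.le]
      congr 1
      field_simp
    rw [e] at h
    exact (ENNReal.mul_le_mul_iff_right ((ENNReal.ofReal_pos.2 hr).ne') ENNReal.ofReal_ne_top).1 h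
  have hK : K = 0 := by
    refine le_antisymm ?_ bot_le
    have ht : Tendsto (fun n : ℕ ↦ ENNReal.ofReal (C * (1 / ((n : ℝ) + 1)))) atTop (𝓝 0) := by
      have h1 := (tendsto_one_div_add_atTop_nhds_zero_nat (𝕜 := ℝ)).const_mul C
      rw [mul_zero] at h1
      have h2 := ENNReal.tendsto_ofReal h1
      rwa [ENNReal.ofReal_zero] at h2
    exact ge_of_tendsto' ht hKle
  -- a.e. pairs: `Z × P` is null
  have hae : ∀ᵐ x : ℝ, ∀ᵐ y : ℝ, ENNReal.ofReal (k x y) = 0 :=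
    ae_pair_eq_zero_of_ae_lintegral_shift (F := fun x y ↦ ENNReal.ofReal (k x y))
      (ENNReal.measurable_ofReal.comp hkm) (fun x y ↦ by rw [hksymm])
      (ae_lintegral_shift_eq_zero hkm hk0 (by rw [← hKdef]; exact hK))
  have hnot : ∀ᵐ x : ℝ, x ∈ Z → ∀ᵐ y : ℝ, y ∉ P := by
    filter_upwards [hae] with x hx hxZ
    filter_upwards [hx] with y hy hyP
    have h1 : k x y = 0 := le_antisymm (ENNReal.ofReal_eq_zero.1 hy) (hk0 x y)
    have h2 : k₀ x y = ψ x * Φ y := by simp only [hk₀def, if_pos (And.intro hxZ hyP)]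
    have h3 : 0 < ψ x * Φ y := mul_pos (hψpos x hxZ.1) hyP.2
    have h4 : k₀ x y ≤ k x y := le_add_of_nonneg_right (hk₀0 y x)
    linarith
  have hZ0 : volume Z = 0 := by
    rw [measure_eq_zero_iff_ae_notMem]
    filter_upwards [hnot] with x hx hxZ
    exact hP (measure_eq_zero_iff_ae_notMem.2 (hx hxZ))
  -- conclusion
  rw [ae_iff]
  have hsub : {x : ℝ | ¬(x ∈ Ioo (-a) a → 0 < Φ x)} ⊆ Z := by
    intro x hx
    have hx' : x ∈ Ioo (-a) a ∧ ¬ 0 < Φ x := Classical.not_imp.1 hx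
    exact ⟨hx'.1, le_antisymm (not_lt.1 hx'.2) (h0 x)⟩
  exact measure_mono_null hsub hZ0

end Summit.RiemannHypothesis.RiemannHypothesis.Theorems.WeilGroundStateMarkovPart

end
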